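import Summits.KontsevichZagierPeriods.KontsevichZagierPeriods.Theses.HurwitzMicroSectors
import Summits.KontsevichZagierPeriods.KontsevichZagierPeriods.Theorems.HurwitzMicroSectorsNormalFormPrinciplePiBoxTransfer
import Summits.KontsevichZagierPeriods.KontsevichZagierPeriods.Theorems.HurwitzMicroSectorsNormalFormPrincipleVariants2320
import Summits.KontsevichZagierPeriods.KontsevichZagierPeriods.Theorems.HurwitzMicroSectorsNormalFormPrincipleVariants2283

/-! TTRL-lite variant V2281 of stmt-KontsevichZagierPeriods-3869

Variant V2281 = `stub_boxRigidity` (the leaf `BoxRigidity` of `NormalFormPrinciple`: two BOX-RATIONAL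
representations — domain the open unit box, integrand `p/q` with `p, q` over `ℚ`, `q ≠ 0` on the box —
with equal values are KZ-equivalent) under the move `fix_nat:m=4; bound_nat:m'≤8` (left dimension
frozen to `4`, right dimension `m' ≤ 8`). Verdict of the attempt seat: **open** — this file is the
exact-strength certificate, not a proof of the variant. The bound EXCEEDS the frozen dimension, so the
strength is set by the right-hand side: by the tree's general fact
`boxRigidityFixBound_iff_boxVanishing_snd` (file `…Variants2320`, case `K = 4 ≤ b = 8`) the variant is
EXACTLY BoxVanishing in dimension `8` — every box-rational representation on `(0,1)⁸` of value `0` is a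
KZ relation (`stub_boxRigidity_var2281_iff_boxVanishing_eight`): forward by comparing the zero
representation on `(0,1)⁴` (box-rational, value `0`, itself a relation) with a vanishing representation
on `(0,1)⁸` (the pair `(4, 8)` is allowed), backward by padding both representations to `(0,1)⁸` by unit
intervals (one Newton–Leibniz move each) and subtracting there (rule 1b; `boxRigidityLe_of_boxVanishing`,
file `…Variants2239`). Sharper: already the SINGLE pair of dimensions `(4, 8)` — the sibling V2280
(`fix m := 4; fix m' := 8`, certified `⟺ BoxVanishing 8` in `…Variants2280`) — carries the whole variant
(`stub_boxRigidity_var2281_iff_var2280`, via the pair lemma `boxRigidityPair_iff_boxVanishingDim 4 8` of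
`…Variants2283`), so the bound `m' ≤ 8` is idle except at `m' = 8`. Equivalently: BoxRigidity under the
joint bound `m, m' ≤ 8` (`stub_boxRigidity_var2281_iff_le_eight`), hence V2281 coincides with the sibling
V2320 (`fix_nat:m=8; bound_nat:m'≤2`, `stub_boxRigidity_var2281_iff_var2320`) and with every two-sided
sibling of maximal dimension `8` (V2232–V2234, V2262–V2264, V2319, V2323, V2324, V2334–V2336, V2347,
V2348, V2359 — all certified `⟺ BoxVanishing 8` in the tree), and with its mirror
`bound_nat:m≤8; fix_nat:m'=4` (`stub_boxRigidity_var2281_iff_mirror`). Downward it gives BoxVanishing in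
every dimension `≤ 8` (`boxVanishing_le_eight_of_stub_boxRigidity_var2281`) and the sibling V2278
(`m = 4, m' ≤ 6`, = BoxVanishing `6`; `stub_boxRigidity_var2278_of_var2281`). BoxVanishing `8` is
Conjecture 1 of Kontsevich–Zagier in kernel form for all rational integrands over `ℚ` on the boxes
`(0,1)^{≤ 8}` (`π⁸`, `ζ(3)ζ(5)`, `ζ(3,5)`, `ζ(7)`, `ζ(5)`, `ζ(3)²` versus `π⁶`, Catalan's `G` versus `ℚ`,
`ζ(3)` versus `ℚ + ℚπ²`, …): every side condition of a move is a sentence of the theory of real closed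
fields over `ℚ`, independent of the value, so a proof must convert the numerical hypothesis `value = 0`
into a chain of moves uniformly in the rational parameters — for `[(0,1)², (1 - c(1+x²y²))/(1+x²y²)]`
(value `G - c`) this is an irrationality proof of `G`, open; the tree proves only dimension `≤ 1`
(`boxRigidity_of_le_one`, Baker). Conversely `KontsevichZagierPeriods ⇒ parent ⇒ V2281`
(`stub_boxRigidity_var2281_of_statement`), so a refutation of the variant would refute the Summit, and no
invariant of `KZ.relations` finer than `eval` is known (soundness `relations_le_ker_eval_holds` is the
only one in the tree).
Source: M. Kontsevich, D. Zagier, *Periods* (2001), §1.2 Conjecture 1. Pure proof file, no definitions. -/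

-- `Summit.<Summit>.<Problem>` is the tree's mandated summit-side namespace (CONVENTIONS §2); for this
-- single-conjunct summit the two coincide, so the duplicate is deliberate.
set_option linter.dupNamespace false

noncomputable section

namespace Summit.KontsevichZagierPeriods.KontsevichZagierPeriods.Theorems

open MeasureTheory Set
open Literature.NumberTheory.Transcendental Literature.NumberTheory.Transcendental.KZ
open Summit.KontsevichZagierPeriods.KontsevichZagierPeriods.Theses.HurwitzMicroSectors
open Summit.KontsevichZagierPeriods.HurwitzMicroSectors.NormalFormPrinciple.PiBox

/-! ## The variant V2281: exactly `BoxVanishing 8` -/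

/-- **V2281 ⟺ BoxVanishing in dimension `8`** (every box-rational representation on `(0,1)⁸` of
value `0` is a KZ relation): instance `K = 4 ≤ b = 8` of `boxRigidityFixBound_iff_boxVanishing_snd`.
[cite: KontsevichZagier2001, §1.2 Conjecture 1] -/
theorem stub_boxRigidity_var2281_iff_boxVanishing_eight :
    (∀ (m' : ℕ) (N : IntegralRep 4) (N' : IntegralRep m'), m' ≤ 8 → N.domain = {x | ∀ i, x i ∈ Set.Ioo (0:ℝ) 1} → N.IsRational → N'.domain = {x | ∀ i, x i ∈ Set.Ioo (0:ℝ) 1} → N'.IsRational → N.value = N'.value → Equivalent N N') ↔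
    (∀ (M : IntegralRep 8), M.domain = {x | ∀ i, x i ∈ Set.Ioo (0:ℝ) 1} → M.IsRational →
      M.value = 0 → of M ∈ relations) :=
  boxRigidityFixBound_iff_boxVanishing_snd (by norm_num)

/-- **V2281 ⟺ its top pair `(4, 8)`, the sibling V2280** (`fix m := 4; fix m' := 8`; the honest locus of
the variant's strength: the eight allowed right dimensions `m' ≤ 7` add nothing to `m' = 8`, both sides
being BoxVanishing `8` — `boxRigidityPair_iff_boxVanishingDim 4 8`, `max 4 8 = 8` by computation; the
right-hand side is verbatim the sibling certificate's `stub_boxRigidity_var2280_iff_boxVanishing_eight`).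
[cite: KontsevichZagier2001, §1.2 Conjecture 1] -/
theorem stub_boxRigidity_var2281_iff_var2280 :
    (∀ (m' : ℕ) (N : IntegralRep 4) (N' : IntegralRep m'), m' ≤ 8 → N.domain = {x | ∀ i, x i ∈ Set.Ioo (0:ℝ) 1} → N.IsRational → N'.domain = {x | ∀ i, x i ∈ Set.Ioo (0:ℝ) 1} → N'.IsRational → N.value = N'.value → Equivalent N N') ↔
    (∀ (N : IntegralRep 4) (N' : IntegralRep 8),
      N.domain = {x | ∀ i, x i ∈ Set.Ioo (0:ℝ) 1} → N.IsRational →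
      N'.domain = {x | ∀ i, x i ∈ Set.Ioo (0:ℝ) 1} → N'.IsRational →
      N.value = N'.value → Equivalent N N') := by
  rw [stub_boxRigidity_var2281_iff_boxVanishing_eight]
  exact (boxRigidityPair_iff_boxVanishingDim 4 8).symm

/-- **V2281 ⟺ BoxRigidity under the joint bound `m, m' ≤ 8`** (the honest strength of the variant:
freezing `m := 4` loses nothing once `m' ≤ 8` is allowed; this right-hand side is verbatim that of the
sibling certificate `stub_boxRigidity_var2320_iff_le_eight`). [cite: KontsevichZagier2001, §1.2 Conjecture 1] -/
theorem stub_boxRigidity_var2281_iff_le_eight :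
    (∀ (m' : ℕ) (N : IntegralRep 4) (N' : IntegralRep m'), m' ≤ 8 → N.domain = {x | ∀ i, x i ∈ Set.Ioo (0:ℝ) 1} → N.IsRational → N'.domain = {x | ∀ i, x i ∈ Set.Ioo (0:ℝ) 1} → N'.IsRational → N.value = N'.value → Equivalent N N') ↔
    (∀ (m m' : ℕ) (N : IntegralRep m) (N' : IntegralRep m'), m' ≤ 8 → m ≤ 8 →
      N.domain = {x | ∀ i, x i ∈ Set.Ioo (0:ℝ) 1} → N.IsRational →
      N'.domain = {x | ∀ i, x i ∈ Set.Ioo (0:ℝ) 1} → N'.IsRational →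
      N.value = N'.value → Equivalent N N') := by
  rw [stub_boxRigidity_var2281_iff_boxVanishing_eight]
  exact ⟨fun hvan => boxRigidityLe_of_boxVanishing (j := 8) (k := 8) le_rfl le_rfl hvan,
    fun h => boxVanishing_of_boxRigidityLe (j := 8) (k := 8) le_rfl h⟩

/-- **V2281 ⟺ the sibling V2320** (`fix_nat:m=8; bound_nat:m'≤2`): both are BoxVanishing `8`, so the
two programmatic moves produce the same statement. [cite: KontsevichZagier2001, §1.2 Conjecture 1] -/
theorem stub_boxRigidity_var2281_iff_var2320 :
    (∀ (m' : ℕ) (N : IntegralRep 4) (N' : IntegralRep m'), m' ≤ 8 → N.domain = {x | ∀ i, x i ∈ Set.Ioo (0:ℝ) 1} → N.IsRational → N'.domain = {x | ∀ i, x i ∈ Set.Ioo (0:ℝ) 1} → N'.IsRational → N.value = N'.value → Equivalent N N') ↔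
    (∀ (m' : ℕ) (N : IntegralRep 8) (N' : IntegralRep m'), m' ≤ 2 →
      N.domain = {x | ∀ i, x i ∈ Set.Ioo (0:ℝ) 1} → N.IsRational →
      N'.domain = {x | ∀ i, x i ∈ Set.Ioo (0:ℝ) 1} → N'.IsRational →
      N.value = N'.value → Equivalent N N') := by
  rw [stub_boxRigidity_var2281_iff_boxVanishing_eight, stub_boxRigidity_var2320_iff_boxVanishing_eight]

/-- **V2281 ⟺ its mirror `bound_nat:m≤8; fix_nat:m'=4`** (the RIGHT dimension frozen to `4`, the left
bounded by `8`): `Equivalent` is symmetric, so the frozen side is immaterial.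
[cite: KontsevichZagier2001, §1.2 Conjecture 1] -/
theorem stub_boxRigidity_var2281_iff_mirror :
    (∀ (m' : ℕ) (N : IntegralRep 4) (N' : IntegralRep m'), m' ≤ 8 → N.domain = {x | ∀ i, x i ∈ Set.Ioo (0:ℝ) 1} → N.IsRational → N'.domain = {x | ∀ i, x i ∈ Set.Ioo (0:ℝ) 1} → N'.IsRational → N.value = N'.value → Equivalent N N') ↔
    (∀ (m : ℕ) (N : IntegralRep m) (N' : IntegralRep 4), m ≤ 8 →
      N.domain = {x | ∀ i, x i ∈ Set.Ioo (0:ℝ) 1} → N.IsRational →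
      N'.domain = {x | ∀ i, x i ∈ Set.Ioo (0:ℝ) 1} → N'.IsRational →
      N.value = N'.value → Equivalent N N') :=
  ⟨fun h m N N' hm hNd hNr hN'd hN'r hv => (h m N' N hm hN'd hN'r hNd hNr hv.symm).symm,
    fun h m' N N' hm' hNd hNr hN'd hN'r hv => (h m' N' N hm' hN'd hN'r hNd hNr hv.symm).symm⟩

/-- **V2281 ⇒ BoxVanishing in every dimension `≤ 8`** (monotonicity along padding,
`boxVanishing_mono`); the first open level is `2`. [cite: KontsevichZagier2001, §1.2 Conjecture 1] -/
theorem boxVanishing_le_eight_of_stub_boxRigidity_var2281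
    (h : ∀ (m' : ℕ) (N : IntegralRep 4) (N' : IntegralRep m'), m' ≤ 8 → N.domain = {x | ∀ i, x i ∈ Set.Ioo (0:ℝ) 1} → N.IsRational → N'.domain = {x | ∀ i, x i ∈ Set.Ioo (0:ℝ) 1} → N'.IsRational → N.value = N'.value → Equivalent N N')
    {j : ℕ} (hj : j ≤ 8) (N : IntegralRep j) (hNd : N.domain = {x | ∀ i, x i ∈ Set.Ioo (0:ℝ) 1})
    (hNr : N.IsRational) (hv : N.value = 0) : of N ∈ relations :=
  boxVanishing_mono hj (stub_boxRigidity_var2281_iff_boxVanishing_eight.1 h) N hNd hNr hv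

/-- **BoxVanishing `8` ⇒ V2281** (the converse reading of the certificate, in the form a future proof of
the dimension-`8` kernel statement would be consumed). [cite: KontsevichZagier2001, §1.2 Conjecture 1] -/
theorem stub_boxRigidity_var2281_of_boxVanishing_eight
    (hvan : ∀ (M : IntegralRep 8), M.domain = {x | ∀ i, x i ∈ Set.Ioo (0:ℝ) 1} → M.IsRational →
      M.value = 0 → of M ∈ relations) :
    ∀ (m' : ℕ) (N : IntegralRep 4) (N' : IntegralRep m'), m' ≤ 8 → N.domain = {x | ∀ i, x i ∈ Set.Ioo (0:ℝ) 1} → N.IsRational → N'.domain = {x | ∀ i, x i ∈ Set.Ioo (0:ℝ) 1} → N'.IsRational → N.value = N'.value → Equivalent N N' :=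
  stub_boxRigidity_var2281_iff_boxVanishing_eight.2 hvan

/-- **V2281 ⇒ the sibling V2278** (`fix_nat:m=4; bound_nat:m'≤6`, = BoxVanishing `6`): restrict the
bound. [cite: KontsevichZagier2001, §1.2 Conjecture 1] -/
theorem stub_boxRigidity_var2278_of_var2281
    (h : ∀ (m' : ℕ) (N : IntegralRep 4) (N' : IntegralRep m'), m' ≤ 8 → N.domain = {x | ∀ i, x i ∈ Set.Ioo (0:ℝ) 1} → N.IsRational → N'.domain = {x | ∀ i, x i ∈ Set.Ioo (0:ℝ) 1} → N'.IsRational → N.value = N'.value → Equivalent N N') :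
    ∀ (m' : ℕ) (N : IntegralRep 4) (N' : IntegralRep m'), m' ≤ 6 → N.domain = {x | ∀ i, x i ∈ Set.Ioo (0:ℝ) 1} → N.IsRational → N'.domain = {x | ∀ i, x i ∈ Set.Ioo (0:ℝ) 1} → N'.IsRational → N.value = N'.value → Equivalent N N' :=
  fun m' N N' hm' => h m' N N' (hm'.trans (by norm_num))

/-- **The parent leaf ⇒ V2281** (specialisation `m = 4`; the bound `m' ≤ 8` is dropped).
[cite: KontsevichZagier2001, §1.2 Conjecture 1] -/
theorem stub_boxRigidity_var2281_of_parent
    (h : ∀ (m m' : ℕ) (N : IntegralRep m) (N' : IntegralRep m'), N.domain = {x | ∀ i, x i ∈ Set.Ioo (0:ℝ) 1} → N.IsRational → N'.domain = {x | ∀ i, x i ∈ Set.Ioo (0:ℝ) 1} → N'.IsRational → N.value = N'.value → Equivalent N N') :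
    ∀ (m' : ℕ) (N : IntegralRep 4) (N' : IntegralRep m'), m' ≤ 8 → N.domain = {x | ∀ i, x i ∈ Set.Ioo (0:ℝ) 1} → N.IsRational → N'.domain = {x | ∀ i, x i ∈ Set.Ioo (0:ℝ) 1} → N'.IsRational → N.value = N'.value → Equivalent N N' :=
  fun m' N N' _ => h 4 m' N N'

/-- **`KontsevichZagierPeriods ⇒ V2281`**: the variant is a special case of Conjecture 1 for the
tree's calculus (`leaves_of_statement`) — so a refutation of the variant would refute the Summit.
[cite: KontsevichZagier2001, §1.2 Conjecture 1] -/
theorem stub_boxRigidity_var2281_of_statement (h : _root_.KontsevichZagierPeriods) :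
    ∀ (m' : ℕ) (N : IntegralRep 4) (N' : IntegralRep m'), m' ≤ 8 → N.domain = {x | ∀ i, x i ∈ Set.Ioo (0:ℝ) 1} → N.IsRational → N'.domain = {x | ∀ i, x i ∈ Set.Ioo (0:ℝ) 1} → N'.IsRational → N.value = N'.value → Equivalent N N' :=
  stub_boxRigidity_var2281_of_parent (leaves_of_statement h).1

end Summit.KontsevichZagierPeriods.KontsevichZagierPeriods.Theorems

end
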